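import Summits.Langlands.Langlands.Theses.RamifiedCoefficientSeed
import Summits.Langlands.Langlands.Theorems.AdjointLiftingGL3.Negative.SeedAdmitsEisenstein
import Summits.Langlands.Langlands.Theorems.AdjointLiftingGL3.Negative.EisensteinFailsResidualIrreducibility
import HarnessLib

/-!
# Disproof of `AdjointLiftingGL3` — findings (crux stmt-Langlands-16779, cdisprove cycle 1)

Crux (route `RamifiedCoefficientSeed`, decl
`Summit.Langlands.Langlands.Theses.RamifiedCoefficientSeed.AdjointLiftingGL3`): for `p ≥ 11` and
`ρ : Γ_ℚ →ₜ* GL₃(ℚ̄_p)` unramified a.e., crystalline at `p` with labelled HT weights `{0,1,2}`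
(Fontaine's PINNED datum), `ρ̄|_{ℚ(ζ_p)}` absolutely irreducible, and
`tr ρ ≡ η · (tr ρ₀² / det ρ₀ - 1) (mod 𝔪)` for some ODD `ρ₀ : Γ_ℚ →ₜ* GL₂(ℚ̄_p)` and a character `η`
⇒ for every `ι : ℚ̄_p ≃ ℂ` and `hcpt` there is an `L`-algebraic cuspidal `π` on `GL₃(𝔸_ℚ)` with
Satake–Frobenius matching at almost all `v`.

LANDED (tree, sorry-free, axioms standard):
* `Summits/Langlands/Langlands/Theorems/AdjointLiftingGL3/Negative/SeedAdmitsEisenstein.lean`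
  (p158894): `diagRep` (`χ₁ ⊕ ⋯ ⊕ χₙ` framed), `epsPow`, the Eisenstein triple `rhoEis`/`rho0`/`eta`,
  `seed_exact`, `seed_norm_lt_one`, `rho0_isOdd`, `rhoEis_unramified_ae`, `rhoEis_not_isIrreducible`,
  `seedHypotheses_admit_eisenstein`, `adjointLiftingGL3_false_without_residualIrreducibility`.
* `…/Negative/EisensteinFailsResidualIrreducibility.lean` (p159376):
  `not_isIrreducible_of_forall_diagonal`, `rhoEis_restrictField_not_isIrreducible`,
  `rhoEis_not_isResiduallyAbsIrreducible`, `eisenstein_meets_all_but_residualIrreducibility`.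
This workfile imports both and only INDEXES the findings (plus the named `Prop`s below).

## Verdict of cycle 1: NO KILL — the statement is Fontaine–Mazur-shielded

* Any `ρ` meeting the hypotheses is absolutely irreducible (residual absolute irreducibility lifts,
  tree `IsResiduallyAbsIrreducible.isAbsolutelyIrreducible`), geometric (crystalline at `p`,
  unramified a.e.) and regular (`HT = {0,1,2}`), so the conclusion is exactly what Fontaine–Mazur +
  Langlands reciprocity (direction (B) of the summit, `n = 3`, `F = ℚ`) predict.  A genuine
  counterexample `ρ` would refute Fontaine–Mazur; none is known and none can be certified.  The
  seed (`ρ₀` odd, `η`), the bound `11 ≤ p` and the oddness of `ρ₀` are METHOD hypotheses (ACC+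
  Thm 6.1.1 needs `p > n² = 9`; Serre/Khare–Wintenberger needs `ρ̄₀` odd): dropping any of them
  leaves an FM-predicted statement, so no `_false_without_` theorem can exist for them short of
  disproving Fontaine–Mazur.
* Interface audit (elaborated probe, rc 0 with one `sorry`): every predicate in the crux is an
  honest definition — `FramedGaloisRep = Γ_ℚ →ₜ* GL₃(ℚ̄_p)` (continuity recorded),
  `IsUnramifiedAt` (all inertia groups above `v` act trivially), `IsResiduallyAbsIrreducible`
  (some reduction over `ℤ̄_p/𝔪` of an integral model is absolutely irreducible), `restrictField`
  along the genuine, injective `absGaloisRestrict ℚ ℚ(ζ_p)`, `IsOdd` via `IsComplexConjugation`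
  (inhabited: `exists_isComplexConjugation`), the norm on `PadicAlgCl p` is Mathlib's spectral
  `p`-adic norm (so `‖·‖ < 1` = "in `𝔪_{ℤ̄_p}`"), `CuspidalAutomorphicRepData`/`HasSatakeParamAt`/
  `IsLAlgebraic` are Borel–Jacquet objects, `arithFrobPolyOfSatake ι q 1 α` has roots `ι⁻¹(α_j⁻¹)`
  (BG `L`-normalisation; satisfiable — same pattern as the accepted GL₂ conversion
  `oddPrimesRegularFM_of_tateTwistModularity`), `PadicAlgCl.nonempty_ringEquiv_complex` and
  `isCompact_glFiniteIntegralLevel_holds` make `∀ ι hcpt` non-vacuous.  No junk model, no vacuity: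
  the crystalline/HT clause refers to the `ε`-pinned `fontainePstAdicCompletion`, which is opaque
  (neither provable nor refutable for an explicit `ρ` beyond clauses (F1)–(F12)), so the hypotheses
  cannot be shown unsatisfiable either.
* Cheap tactics: `simp`, `aesop` (exhaustive search) fail on the crux; `exact?`/`decide`
  inapplicable (no decidable shadow: the crux has no finite instance).
* Finite shadow of the METHOD (not of the statement): enormousness of `ad⁰`-images.  `p = 5, 7`
  fail (`H¹(SL₂(𝔽_p), Sym^{p-3}) ≠ 0`, tree `Subgroup.not_isEnormous_of_natCast_eq_zero`), which
  is why the crux carries `11 ≤ p`; for `p ≥ 11` every overgroup of `SL₂(𝔽_p)` in `GL₂(𝔽̄_p)` has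
  enormous `Sym²`-image (ACC+ §7.1, `l > 2n+1 = 7`), and `A₄/S₄/A₅` projective images of `ρ̄₀` are
  excluded by the FL inertia shape (niveau 1: `{c, c+d, c-d} ≡ {0,-1,-2}` forces `c ≡ -1`,
  `d ≡ ±1 (mod p-1)`, projective inertia order `p-1 ≥ 10`; niveau 2: `m ≡ 1 (mod p+1)`, order
  `p+1 ≥ 12`; niveau 3 impossible for `η̄ ⊗ ad⁰` — all `> 5`).  Nothing to decide here.
* `ledger negatives --problem Langlands` (4 entries: SplitPrimeInduction ×2, OrdinaryPrimeTransport,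
  K3KugaSatakeDescent) — none of this crux's shape.

## What IS load-bearing, as theorems: residual (absolute) irreducibility over `ℚ(ζ_p)`

The EISENSTEIN representation `ρ_Eis = 1 ⊕ ε⁻¹ ⊕ ε⁻²` satisfies the seed congruence EXACTLY —
`tr ρ_Eis = η (tr ρ₀²/det ρ₀ - 1)` with the ODD `ρ₀ = 1 ⊕ ε⁻¹` and `η = ε⁻¹` (`seed_exact`) —, is
unramified away from `p` (`rhoEis_unramified_ae`), and FAILS exactly the crux's residual hypothesis
(`rhoEis_not_isResiduallyAbsIrreducible`; packaged: `eisenstein_meets_all_but_residualIrreducibility`).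
For Fontaine's datum it is crystalline with labelled HT weights `{0,1,2}` (`HT(ε^m) = {-m}`, clause
(F11)), and by Jacquet–Shalika no cuspidal `π` on `GL₃` matches it (Satake ratios `q_v, q_v²`).
Hence `adjointLiftingGL3_false_without_residualIrreducibility` (landed, inline form) =
`adjointLiftingGL3WithoutResidualIrreducibility_false` below: the crux with the hypothesis
`IsResiduallyAbsIrreducible` deleted is FALSE modulo the two named inputs
`EisensteinWitnessCrystalline p` (pinned-datum clause, not among (F1)–(F12)) and
`EisensteinWitnessNotCuspidal p` (JS (5.1.3) for `CuspidalAutomorphicRepData`, not yet bridged in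
the tree).  Moral for provers: the seed hypothesis does NOT carry irreducibility of `ρ̄₀` or of
`ad⁰ρ̄₀`; every use of "`ρ̄ ≅ η̄ ⊗ ad⁰ρ̄₀` with `ρ̄₀` irreducible non-dihedral" must be DERIVED from
`IsResiduallyAbsIrreducible (ρ.restrictField (CyclotomicField p ℚ))` (Brauer–Nesbitt on traces,
`p ≥ 11 > 3`), exactly as stub B of line `birth` plans.

## Hypotheses that are load-bearing on paper but not formalisable today

* `∀ᶠ v, ρ.IsUnramifiedAt v`: continuous `p`-adic representations of `Γ_ℚ` ramified at infinitely
  many primes exist (Ramakrishna, *Infinitely ramified Galois representations*, Ann. of Math. 151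
  (2000)); with residual image `ad⁰` of a modular `ρ̄₀` they meet every other hypothesis except
  crystallinity bookkeeping, and are not automorphic.  No construction in the tree.
* crystalline + `HT = {0,1,2}`: non-de Rham lifts of `η̄ ⊗ ad⁰ρ̄₀` unramified outside `p` exist in
  `p`-adic families (generic points of the ordinary/trianguline deformation space); they match no
  `L`-algebraic `π`.  No construction in the tree, and the pinned datum is opaque anyway.

## Open for a later cycle / for other seats (not filed: outside this crux)

* `EisensteinWitnessCrystalline` is not a consequence of clauses (F1)–(F12) of `IsFontaineDatum`;
  a literature seat could add "direct sums of powers of `ε` are `𝔇`-crystalline with the union of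
  the labelled weights" as a clause (Upgrade path of `FontaineDpst`).  The sibling crux
  `ExplicitRamifiedFamily` faces the same opacity for its explicit family.
* `EisensteinWitnessNotCuspidal` needs the bridge `CuspidalAutomorphicRepData ↔ L²_cusp`
  (`exists_isAssociatedL2`, `hasSatakeParamAt_iff_L2`) + the named fact
  `norm_satakeParameter_le_sqrt` + the `|det|` twist to `A_G`-invariance; all present as
  facts/defs, not assembled.

`-- Targets`: none served (payload.targets = [], no stuck stubs at 2026-08-17).
-/

noncomputable section

open scoped MatrixGroups NumberField
open NumberField IsDedekindDomain Filter Field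
open Literature.NumberTheory.GaloisRepresentations Literature.NumberTheory.Automorphic
open Summit.Langlands.Langlands.Theses.RamifiedCoefficientSeed
open Summit.Langlands.Langlands.Theorems.AdjointLiftingGL3.Negative

namespace Summit.Langlands.Langlands.Cruxes.AdjointLiftingGL3.Disproof

set_option linter.dupNamespace false -- project-wide option; `Summit.Langlands.Langlands` is the mandated namespace

variable (p : ℕ) [Fact p.Prime]

/-! ### (a) Load-bearing analysis: the crux without residual irreducibility -/

/-- The crux `AdjointLiftingGL3` with the hypothesis
`(ρ.restrictField (CyclotomicField p ℚ)).IsResiduallyAbsIrreducible` DELETED (verbatim otherwise). -/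
def AdjointLiftingGL3WithoutResidualIrreducibility : Prop :=
  ∀ (p : ℕ) [Fact p.Prime], 11 ≤ p → ∀ ρ : Literature.NumberTheory.GaloisRepresentations.FramedGaloisRep ℚ (PadicAlgCl p) 3, (∀ᶠ v : IsDedekindDomain.HeightOneSpectrum (NumberField.RingOfIntegers ℚ) in Filter.cofinite, ρ.IsUnramifiedAt v) → (∀ (v : IsDedekindDomain.HeightOneSpectrum (NumberField.RingOfIntegers ℚ)) (hv : ((p : ℕ) : NumberField.RingOfIntegers ℚ) ∈ v.asIdeal), let D := Literature.NumberTheory.PAdicHodge.fontainePstAdicCompletion v p hv; D.IsCrystallineFramed (ρ.toLocal v) ∧ (letI := D.algebra; ∀ τ : v.adicCompletion ℚ →ₐ[ℚ_[p]] PadicAlgCl p, ρ.labelledHodgeTateWeightsAt v D.algebra D.𝔅 τ.toRingHom = {0, 1, 2})) → (∃ (ρ₀ : Literature.NumberTheory.GaloisRepresentations.FramedGaloisRep ℚ (PadicAlgCl p) 2) (η : Literature.NumberTheory.GaloisRepresentations.FramedGaloisRep ℚ (PadicAlgCl p) 1), ρ₀.IsOdd ∧ ∀ σ, ‖(ρ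 σ).val.trace - (η σ).val 0 0 * ((ρ₀ σ).val.trace ^ 2 * ((ρ₀ σ).val.det)⁻¹ - 1)‖ < 1) → ∀ (ι : PadicAlgCl p ≃+* ℂ) (hcpt : Literature.NumberTheory.Automorphic.isCompact_glFiniteIntegralLevel 3 ℚ), ∃ π : Literature.NumberTheory.Automorphic.CuspidalAutomorphicRepData 3 ℚ hcpt, π.1.IsLAlgebraic ∧ ∀ᶠ v : IsDedekindDomain.HeightOneSpectrum (NumberField.RingOfIntegers ℚ) in Filter.cofinite, Summit.Langlands.SatakeFrobCompatibleAt ι π.1 ρ v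

/-- Sanity: the weakening differs from the route decl ONLY by the deleted hypothesis. [folklore] -/
theorem adjointLiftingGL3_of_without (h : AdjointLiftingGL3WithoutResidualIrreducibility) :
    AdjointLiftingGL3 := by
  intro p _ hp ρ hunr hcrys _ hseed ι hcpt
  exact h p hp ρ hunr hcrys hseed ι hcpt

/-- **Named input 1 (pinned-datum clause): `ρ_Eis = 1 ⊕ ε⁻¹ ⊕ ε⁻²` is crystalline at `p` with
labelled Hodge–Tate weights `{0,1,2}` for Fontaine's PINNED datum `fontainePstAdicCompletion`.**
True for `(B_dR, WD ∘ D_pst)` (`ℚ_p(m)` crystalline, `D_cris = ℚ_p · t^{-m}`, `HT(ε^m) = {-m}`,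
`D_cris` additive); NOT derivable from the specification clauses (F1)–(F12) of `IsFontaineDatum`.
[cite: FontaineAsterisque223VIII, §1.3 and §2.3.7]
[cite: BrinonConrad2009, §9.1 Prop. 9.1.9 and Prop. 9.1.11] -/
def EisensteinWitnessCrystalline : Prop :=
  ∀ (v : IsDedekindDomain.HeightOneSpectrum (NumberField.RingOfIntegers ℚ))
    (hv : ((p : ℕ) : NumberField.RingOfIntegers ℚ) ∈ v.asIdeal),
    let D := Literature.NumberTheory.PAdicHodge.fontainePstAdicCompletion v p hv
    D.IsCrystallineFramed ((rhoEis p).toLocal v) ∧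
      (letI := D.algebra; ∀ τ : v.adicCompletion ℚ →ₐ[ℚ_[p]] PadicAlgCl p,
        (rhoEis p).labelledHodgeTateWeightsAt v D.algebra D.𝔅 τ.toRingHom = {0, 1, 2})

/-- **Named input 2 (Jacquet–Shalika): no `L`-algebraic cuspidal `π` of `GL₃(𝔸_ℚ)` is
Satake–Frobenius compatible at almost all places with `ρ_Eis = 1 ⊕ ε⁻¹ ⊕ ε⁻²`** (a match forces
Satake parameters `{1, q, q²}` a.e., modulus `q > q^{1/2}` after any unitary twist; the tree's fact
`norm_satakeParameter_le_sqrt` is for the `L²` avatars, bridge unproved).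
[cite: JacquetShalikaAJM1981, Cor. (2.5) p. 515 and (5.1.3) p. 554] -/
def EisensteinWitnessNotCuspidal : Prop :=
  ∀ (ι : PadicAlgCl p ≃+* ℂ) (hcpt : Literature.NumberTheory.Automorphic.isCompact_glFiniteIntegralLevel 3 ℚ)
    (π : Literature.NumberTheory.Automorphic.CuspidalAutomorphicRepData 3 ℚ hcpt),
    π.1.IsLAlgebraic →
      ¬ ∀ᶠ v : IsDedekindDomain.HeightOneSpectrum (NumberField.RingOfIntegers ℚ) in Filter.cofinite,
        Summit.Langlands.SatakeFrobCompatibleAt ι π.1 (rhoEis p) v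

variable {p}

/-- **`AdjointLiftingGL3` is false without residual irreducibility** (modulo the two named inputs
at one prime `p ≥ 11`) — the landed `adjointLiftingGL3_false_without_residualIrreducibility` in the
vocabulary of this file.  Any proof of the crux must use
`IsResiduallyAbsIrreducible (ρ.restrictField (CyclotomicField p ℚ))` — already to exclude
Eisenstein `ρ`. -/
theorem adjointLiftingGL3WithoutResidualIrreducibility_false (hp : 11 ≤ p)
    (H₁ : EisensteinWitnessCrystalline p) (H₂ : EisensteinWitnessNotCuspidal p) :
    ¬ AdjointLiftingGL3WithoutResidualIrreducibility :=
  adjointLiftingGL3_false_without_residualIrreducibility hp H₁ H₂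

/-! ### (b) Tightness: the Eisenstein triple meets everything but the residual hypothesis -/

/-- Re-export (landed): seed + oddness + unramified-a.e. hold and
`IsResiduallyAbsIrreducible (ρ.restrictField (CyclotomicField p ℚ))` FAILS for one and the same `ρ`. -/
theorem tightness_residualIrreducibility :
    ∃ (ρ : FramedGaloisRep ℚ (PadicAlgCl p) 3) (ρ₀ : FramedGaloisRep ℚ (PadicAlgCl p) 2)
      (η : FramedGaloisRep ℚ (PadicAlgCl p) 1),
      ρ₀.IsOdd ∧
      (∀ σ, ‖(ρ σ).val.trace - (η σ).val 0 0 * ((ρ₀ σ).val.trace ^ 2 * ((ρ₀ σ).val.det)⁻¹ - 1)‖ < 1) ∧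
      (∀ᶠ v : HeightOneSpectrum (𝓞 ℚ) in cofinite, ρ.IsUnramifiedAt v) ∧
      ¬ (ρ.restrictField (CyclotomicField p ℚ)).IsResiduallyAbsIrreducible :=
  eisenstein_meets_all_but_residualIrreducibility p

/-! ### (c) Natural strengthenings: none decidable

No finite/decidable instance of the crux exists (it quantifies over continuous `ρ : Γ_ℚ → GL₃(ℚ̄_p)`
and the pinned `p`-adic Hodge datum); the finite shadow of the METHOD (enormous `ad⁰`-images) is
clean for `p ≥ 11` (see the module docstring), and the `p = 5, 7` failures are already excluded by
the crux's own bound `11 ≤ p`. -/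

/-! ### (d) Targets: none (payload.targets = []). -/

/-! ### (e) Near-misses: none sorried. -/

end Summit.Langlands.Langlands.Cruxes.AdjointLiftingGL3.Disproof

end
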